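/-
Copyright: the b2b-balaban T⁴-continuum CRUX team, row NE7b leaf lineage `t4-ne7b-formalise-leaf-01` (gen 88). Project licence.
-/
import Mathlib.Analysis.Normed.Operator.Basic
import Mathlib.Analysis.Complex.Exponential
import Mathlib.Analysis.Seminorm

/-!
# DUHAMEL–GRÖNWALL CONTROL OF A PERTURBED TOWER's COMPOSITE SECTIONS: if every CONSECUTIVE product of the reference steps is bounded,
# `‖A_a ∘ ⋯ ∘ A_{b−1}‖ ≤ C·θ^{b−a}`, and each step is perturbed by `‖F_j − A_j‖ ≤ ε_j`, then the perturbed composite `P_k = F_0 ∘ ⋯ ∘ F_{k−1}`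
# obeys `‖P_k‖ ≤ C·θ^k·∏_{j<k}(1 + C·ε_j∕θ)` and `‖P_k − A_0∘⋯∘A_{k−1}‖ ≤ C·θ^k·(∏_{j<k}(1 + C·ε_j∕θ) − 1)` — the CONTROLLED PRODUCT: the reference
# tower enters through ONE constant for all its sub-towers (a closed form ∕ one-shot letter), the perturbation only through `Σ_j ε_j`
# (row NE7b, node U5c; PRICING-NE7b v133–v135 §3 R-P1 limb 1a (i) «closed form OR controlled product — SECS displays the product, no control»;
# Mathlib only; [folklore]: the discrete Duhamel formula + a Volterra-form Grönwall lemma)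

Cell `pub-balaban`, sub-cell `t4`, spine estimate NE7b (`T4WeightBudget.RelWeightBound`; the cell's OWN estimate — NOT PRINTED in
[Bałaban 1983–89], NOT PROVED).  Crux-route work under `Spine/NE7b/` by a row leaf (`t4-ne7b-formalise-leaf-01` gen 88) under FREEZE (0)'s
crux-prover clause; NOTHING of Bałaban's is named as a Lean object, valued or asserted; no `T4Continuum/Support` leaf typed; no `def` (the
perturbed composites `P k : X k →L X 0`, the reference composites `R a b : X b →L X a`, the steps `F j`, `A j : X (j+1) →L X j` and the constants
`C, θ, ε` are CARRIED BY HYPOTHESES with their recursion equations displayed — the shape of `…SupEquationTowerSections` (SECS), whose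
`𝒮 (k+1) = 𝒮 k ∘ (T_k⁻¹ ∘ inl)` is this file's `P (k+1) = P k ∘ F k`); zero `sorry`.  Imports: Mathlib only (operator norm; `Real.exp`; `Seminorm`) —
independent of the hub's olean frontier.

WHY (located).  SECS (`…SupEquationTowerSections.tower_eq_sections`, leaf-06 g161) proves that the tower's linearised composite section is the
composite of the charts' sections, `𝒮_{k+1} = 𝒮_k ∘ T_k⁻¹ ∘ inl`, and exports for any per-level seminorm letters the PRODUCT constant
`∏_{j<k} N^w_j` — DISPLAYED, «no control» (the author), and by value dead per step in the pure-sup currency at small sides (`N_j ≥ ρ_∞(2) ≥ 2.4972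
> 2`, PRICING-NE7b v132 F784 ∕ v133 F791).  The pricing desk's standing list of what REMAINS on R-P1 limb 1a (v133 F793, v134, v135 §3) names
«the k-UNIFORM letter for the INTERACTING sup column — either a CLOSED FORM (BASG's (1.16) exists only for the scalar torus Gaussian flow, F794)
or a CONTROLLED PRODUCT».  THIS FILE is the abstract bookkeeping that COMBINES the two: split each interacting step section `F_j = T_j⁻¹ ∘ inl`
into the FREE step section `A_j` plus a perturbation of size `ε_j` (the OWNER's (63) `eq_augInverse_of_solution` ∕ (64) `weighted_modulus_letters`:
`O(λ_j)`); the free sub-towers `A_a ∘ ⋯ ∘ A_{b−1}` are ONE-SHOT free sections (leaf-04 STG `twoSteps_eq_oneShot`, leaf-03 HSGT §5, leaf-06 SOS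
`tower_eq_oneShot`, leaf-05 BASG — the semigroup), so ONE letter bounds ALL of them: by name the OWNER's (46) `…OneShotChartSupNorm.abs_HBZd_le_sup`
(`‖H_M‖_{∞→∞} ≤ C_∞` for EVERY side `M`), by truth `sup_M ‖H_M‖_{∞→∞} ≈ 4.45` and `‖H_M‖_{∞→∞}∕M ≤ 1.29` at `d = 4` (F721 ∕ F726 (c)); the discrete
DUHAMEL formula `P_k = R_{0,k} + Σ_{j<k} P_j ∘ (F_j − A_j) ∘ R_{j+1,k}` and a Grönwall lemma in VOLTERRA form (`a_k ≤ C + Σ_{j<k} b_j a_j ⟹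
a_k ≤ C·∏_{j<k}(1 + b_j)`; Mathlib's `discrete_gronwall` is the one-step recurrence form) then give the letters of the title.  Reading: the
interacting composite section is bounded by the FREE one-shot letter times `∏_{j<k}(1 + Cε_j∕θ) ≤ exp((C∕θ)·Σ_{j<k} ε_j)` — k-UNIFORM when the
couplings are summable, GEOMETRIC `C·(θ + Cε)^k` when they are uniformly `≤ ε` (so a rescaled free decay `θ < 1` survives any `ε < (1 − θ)∕C`), and
it DIFFERS from the free one-shot section by `C·θ^k·(∏(1 + Cε_j∕θ) − 1)`.  No factor `N_j ≥ 2.4972` of a single free step is ever multiplied.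

WHAT IS PROVED ([folklore]; `X : ℕ → Type*` real normed spaces; `P : ∀ k, X k →L[ℝ] X 0`, `R : ∀ a b, X b →L[ℝ] X a`, `F A : ∀ j, X (j+1) →L[ℝ] X j`):
* §1 SCALAR LETTERS: `sum_mul_prod_one_add` (telescoping `Σ_{j<k} x_j·∏_{i<j}(1 + x_i) = ∏_{j<k}(1 + x_j) − 1`), **`volterra_gronwall`**
  (`0 ≤ b`, `∀ k, a_k ≤ C + Σ_{j<k} b_j·a_j ⟹ a_k ≤ C·∏_{j<k}(1 + b_j)` — no sign condition on `C` or `a`), `prod_one_add_le_exp`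
  (`∏_{j<k}(1 + b_j) ≤ exp(Σ_{j<k} b_j)`, Mathlib's `Real.prod_one_add_le_exp_sum` by name), `prod_one_add_le_pow` (`b_j ≤ β ⟹ ∏_{j<k}(1 + b_j) ≤ (1 + β)^k`).
* §2 THE DISCRETE DUHAMEL FORMULA **`duhamel`**: `P 0 = 1`, `P (k+1) = P k ∘ F k`, `R a a = 1`, `R a (b+1) = R a b ∘ A b` (`a ≤ b`) ⟹
  `P k = R 0 k + Σ_{j<k} (P j ∘ (F j − A j)) ∘ R (j+1) k`; `duhamel_sub` (the same for `P k − R 0 k`).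
* §3 THE LETTERS: **`norm_le_of_consecutive`** (`0 < θ`, `‖R a b‖ ≤ C·θ^{b−a}` for `a ≤ b`, `‖F j − A j‖ ≤ ε j` ⟹
  `‖P k‖ ≤ C·θ^k·∏_{j<k}(1 + C·ε_j∕θ)`); **`norm_sub_le_of_consecutive`** (`‖P k − R 0 k‖ ≤ C·θ^k·(∏_{j<k}(1 + C·ε_j∕θ) − 1)`);
  `norm_le_of_consecutive_one` (`θ = 1`: `‖P k‖ ≤ C·∏_{j<k}(1 + C·ε_j)`), **`norm_le_uniform_of_summable`** (`Σ_{j<k} ε_j ≤ E` for all `k` ⟹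
  `‖P k‖ ≤ C·exp(C·E)` FOR ALL `k` — the k-UNIFORM letter), **`norm_le_geometric`** (`ε_j ≤ ε` ⟹ `‖P k‖ ≤ C·(θ + C·ε)^k`),
  `norm_sub_le_geometric` (`‖P k − R 0 k‖ ≤ C·((θ + C·ε)^k − θ^k)`).
* §5 THE SECOND CURRENCY (SECS's slot `p : ∀ k, Seminorm ℝ (X k)`): `duhamel_scalar` (the one-step scalar bookkeeping
  `C·θ^k + Σ_{j<k}(C·θ^j·Q_j)·(ε_j·C·θ^{k−(j+1)}) = C·θ^k·Q_k`), **`seminorm_le_of_consecutive`** (reference letters `p_a(R a b v) ≤ C·θ^{b−a}·p_b(v)`,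
  perturbation letters `p_j((F j − A j) v) ≤ ε_j·p_{j+1}(v)`, `0 ≤ C`, `0 ≤ ε` ⟹ **`p_0(P k v) ≤ C·θ^k·∏_{j<k}(1 + C·ε_j∕θ)·p_k(v)`** — SECS's
  `(∏_{j<k} N^w_j)·p_k(v)` with the product CONTROLLED), **`seminorm_le_uniform_of_summable`** (`θ = 1`, `Σ_{j<k} ε_j ≤ E` ⟹ `p_0(P k v) ≤ C·exp(C·E)·p_k(v)`
  for every `k`).
* §6 toy (`X k = ℝ`, `F = A = 1`): the letters by `norm_num`.

HONEST (what this is NOT).  Abstract operator-norm bookkeeping on a chain of Banach levels; the INSTANCE — `F j := T_j⁻¹ ∘ inl` of SECS, `A j :=` the free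
chart's section (ASE at level `j`), `R a b :=` the free composite = one-shot section (the semigroup identification in SECS's currency), `ε_j` from
(63)∕(64), `C, θ` from (46) and the rescaling — is NOT typed here (leaf-04∕06's and the OWNER's lane); the relative ∕ geometric letters of §3 are typed in
the operator-norm currency only; whether Bałaban's `ε_j` ARE summable or uniformly small along the flow is the DISPLAYED input (BetaPertH side — not
here); by value `C = C_∞` of (46) is astronomical (truth 4.45) ⇒ G15-consumable only; nothing of (A3) ∕ (A1c) ∕ NC-NE7b-α; BY-NAME EFFECT ON THE WALL: NONE.  NE7b NOT PRINTED ∕ NOT PROVED; spine PROVED 0∕9; rung (B)+1 on a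
FINITE torus — NOT infinite volume, NOT the mass gap, NOT Clay.  HONEST DEPENDENCY: continuum YM on T⁴ ⇐ BetaPertH ∧ nine spine estimates (0∕9
proved); BetaPertH ⇐ (D1) ∧ (D4) ∧ CAP+tail; G-an2-4 gates asym, D1 and NE2∕3∕4.
-/

set_option autoImplicit false

namespace Summit.QuantumFields.BalabanUV.T4Continuum.NE7b.PerturbedSectionProducts

open Finset

/-! ## §1. Scalar letters: telescoping, Volterra–Grönwall, exponential and geometric envelopes -/

/-- **Telescoping**: `Σ_{j<k} x_j·∏_{i<j}(1 + x_i) = ∏_{j<k}(1 + x_j) − 1`. [folklore] -/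
theorem sum_mul_prod_one_add (x : ℕ → ℝ) (k : ℕ) :
    ∑ j ∈ range k, x j * ∏ i ∈ range j, (1 + x i) = ∏ j ∈ range k, (1 + x j) - 1 := by
  induction k with
  | zero => simp
  | succ k ih => rw [sum_range_succ, prod_range_succ, ih]; ring

/-- **Grönwall in Volterra form**: `0 ≤ b_j` and `a_k ≤ C + Σ_{j<k} b_j·a_j` for every `k` give `a_k ≤ C·∏_{j<k}(1 + b_j)` for every `k`
(strong induction + telescoping; no sign hypothesis on `C` or on `a`). [folklore] -/
theorem volterra_gronwall {a b : ℕ → ℝ} {C : ℝ} (hb : ∀ j, 0 ≤ b j) (h : ∀ k, a k ≤ C + ∑ j ∈ range k, b j * a j) (k : ℕ) :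
    a k ≤ C * ∏ j ∈ range k, (1 + b j) := by
  induction k using Nat.strong_induction_on with
  | _ k ih =>
    calc a k ≤ C + ∑ j ∈ range k, b j * a j := h k
      _ ≤ C + ∑ j ∈ range k, b j * (C * ∏ i ∈ range j, (1 + b i)) := by
          gcongr with j hj
          · exact hb j
          · exact ih j (mem_range.mp hj)
      _ = C * (1 + ∑ j ∈ range k, b j * ∏ i ∈ range j, (1 + b i)) := by
          rw [mul_add, mul_one, mul_sum]
          refine congrArg (C + ·) (sum_congr rfl fun j _ => by ring)
      _ = C * ∏ j ∈ range k, (1 + b j) := by rw [sum_mul_prod_one_add]; ring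

/-- `∏_{j<k}(1 + b_j) ≤ exp(Σ_{j<k} b_j)` for `0 ≤ b` (Mathlib's `Real.prod_one_add_le_exp_sum`). [folklore] -/
theorem prod_one_add_le_exp {b : ℕ → ℝ} (hb : ∀ j, 0 ≤ b j) (k : ℕ) :
    ∏ j ∈ range k, (1 + b j) ≤ Real.exp (∑ j ∈ range k, b j) :=
  Real.prod_one_add_le_exp_sum (range k) hb

/-- `0 ≤ b_j ≤ β ⟹ ∏_{j<k}(1 + b_j) ≤ (1 + β)^k`. [folklore] -/
theorem prod_one_add_le_pow {b : ℕ → ℝ} {β : ℝ} (hb : ∀ j, 0 ≤ b j) (hβ : ∀ j, b j ≤ β) (k : ℕ) :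
    ∏ j ∈ range k, (1 + b j) ≤ (1 + β) ^ k := by
  calc ∏ j ∈ range k, (1 + b j) ≤ ∏ _j ∈ range k, (1 + β) :=
        prod_le_prod (fun j _ => by linarith [hb j]) fun j _ => by linarith [hβ j]
    _ = (1 + β) ^ k := by rw [prod_const, card_range]

/-- `1 ≤ ∏_{j<k}(1 + b_j)` for `0 ≤ b`. [folklore] -/
theorem one_le_prod_one_add {b : ℕ → ℝ} (hb : ∀ j, 0 ≤ b j) (k : ℕ) : 1 ≤ ∏ j ∈ range k, (1 + b j) := by
  calc (1 : ℝ) = ∏ _j ∈ range k, (1 : ℝ) := by simp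
    _ ≤ ∏ j ∈ range k, (1 + b j) := prod_le_prod (fun _ _ => zero_le_one) fun j _ => by linarith [hb j]

/-! ## §2. The discrete Duhamel formula on a chain of levels -/

variable {X : ℕ → Type*} [∀ k, NormedAddCommGroup (X k)] [∀ k, NormedSpace ℝ (X k)]

/-- **THE DISCRETE DUHAMEL FORMULA**: for perturbed composites `P (k+1) = P k ∘ F k`, `P 0 = 1`, and reference composites `R a (b+1) = R a b ∘ A b`
(`a ≤ b`), `R a a = 1`:  `P k = R 0 k + Σ_{j<k} (P j ∘ (F j − A j)) ∘ R (j+1) k`. [folklore] -/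
theorem duhamel (P : ∀ k, X k →L[ℝ] X 0) (R : ∀ a b, X b →L[ℝ] X a) (F A : ∀ j, X (j + 1) →L[ℝ] X j)
    (hP0 : P 0 = ContinuousLinearMap.id ℝ (X 0)) (hP : ∀ k, P (k + 1) = (P k).comp (F k))
    (hR0 : ∀ a, R a a = ContinuousLinearMap.id ℝ (X a)) (hR : ∀ a b, a ≤ b → R a (b + 1) = (R a b).comp (A b)) (k : ℕ) :
    P k = R 0 k + ∑ j ∈ range k, ((P j).comp (F j - A j)).comp (R (j + 1) k) := by
  induction k with
  | zero => simp [hP0, hR0]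
  | succ k ih =>
    have hsplit : (P k).comp (F k) = (P k).comp (A k) + (P k).comp (F k - A k) := by
      rw [ContinuousLinearMap.comp_sub]; abel
    rw [hP k, hsplit, ih, ContinuousLinearMap.add_comp, ContinuousLinearMap.finsetSum_comp, ← hR 0 k (Nat.zero_le k),
      sum_range_succ, hR0 (k + 1), ContinuousLinearMap.comp_id]
    have hterms : ∑ j ∈ range k, (((P j).comp (F j - A j)).comp (R (j + 1) k)).comp (A k)
        = ∑ j ∈ range k, ((P j).comp (F j - A j)).comp (R (j + 1) (k + 1)) :=
      sum_congr rfl fun j hj => by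
        rw [ContinuousLinearMap.comp_assoc, ← hR (j + 1) k (by have := mem_range.mp hj; omega)]
    rw [hterms]
    -- the `ih`-substituted `P k` inside the last term is the original `P k`
    rw [← ih]
    abel

/-- The Duhamel formula for the DIFFERENCE: `P k − R 0 k = Σ_{j<k} (P j ∘ (F j − A j)) ∘ R (j+1) k`. [folklore] -/
theorem duhamel_sub (P : ∀ k, X k →L[ℝ] X 0) (R : ∀ a b, X b →L[ℝ] X a) (F A : ∀ j, X (j + 1) →L[ℝ] X j)
    (hP0 : P 0 = ContinuousLinearMap.id ℝ (X 0)) (hP : ∀ k, P (k + 1) = (P k).comp (F k))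
    (hR0 : ∀ a, R a a = ContinuousLinearMap.id ℝ (X a)) (hR : ∀ a b, a ≤ b → R a (b + 1) = (R a b).comp (A b)) (k : ℕ) :
    P k - R 0 k = ∑ j ∈ range k, ((P j).comp (F j - A j)).comp (R (j + 1) k) := by
  rw [duhamel P R F A hP0 hP hR0 hR k]; abel

/-! ## §3. The letters -/

/-- The norm of one Duhamel term: `‖(P j ∘ (F j − A j)) ∘ R (j+1) k‖ ≤ ‖P j‖·ε_j·(C·θ^{k−(j+1)})`. [folklore] -/
theorem norm_term_le (P : ∀ k, X k →L[ℝ] X 0) (R : ∀ a b, X b →L[ℝ] X a) (F A : ∀ j, X (j + 1) →L[ℝ] X j)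
    {C θ : ℝ} {ε : ℕ → ℝ} (hRC : ∀ a b, a ≤ b → ‖R a b‖ ≤ C * θ ^ (b - a)) (hε : ∀ j, ‖F j - A j‖ ≤ ε j)
    {j k : ℕ} (hjk : j < k) :
    ‖((P j).comp (F j - A j)).comp (R (j + 1) k)‖ ≤ ‖P j‖ * ε j * (C * θ ^ (k - (j + 1))) := by
  calc ‖((P j).comp (F j - A j)).comp (R (j + 1) k)‖ ≤ ‖(P j).comp (F j - A j)‖ * ‖R (j + 1) k‖ :=
        ContinuousLinearMap.opNorm_comp_le _ _
    _ ≤ (‖P j‖ * ‖F j - A j‖) * ‖R (j + 1) k‖ :=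
        mul_le_mul_of_nonneg_right (ContinuousLinearMap.opNorm_comp_le _ _) (norm_nonneg _)
    _ ≤ (‖P j‖ * ε j) * (C * θ ^ (k - (j + 1))) :=
        mul_le_mul (mul_le_mul_of_nonneg_left (hε j) (norm_nonneg _)) (hRC (j + 1) k hjk)
          (norm_nonneg _) (mul_nonneg (norm_nonneg _) ((norm_nonneg _).trans (hε j)))
    _ = ‖P j‖ * ε j * (C * θ ^ (k - (j + 1))) := by ring

/-- **THE PERTURBED COMPOSITE LETTER**: consecutive reference products bounded by `C·θ^{b−a}` (`0 < θ`), steps perturbed by `‖F j − A j‖ ≤ ε_j` ⟹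
`‖P k‖ ≤ C·θ^k·∏_{j<k}(1 + C·ε_j∕θ)`. [folklore] -/
theorem norm_le_of_consecutive (P : ∀ k, X k →L[ℝ] X 0) (R : ∀ a b, X b →L[ℝ] X a) (F A : ∀ j, X (j + 1) →L[ℝ] X j)
    (hP0 : P 0 = ContinuousLinearMap.id ℝ (X 0)) (hP : ∀ k, P (k + 1) = (P k).comp (F k))
    (hR0 : ∀ a, R a a = ContinuousLinearMap.id ℝ (X a)) (hR : ∀ a b, a ≤ b → R a (b + 1) = (R a b).comp (A b))
    {C θ : ℝ} (hθ : 0 < θ) {ε : ℕ → ℝ} (hRC : ∀ a b, a ≤ b → ‖R a b‖ ≤ C * θ ^ (b - a)) (hε : ∀ j, ‖F j - A j‖ ≤ ε j) (k : ℕ) :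
    ‖P k‖ ≤ C * θ ^ k * ∏ j ∈ range k, (1 + C * ε j / θ) := by
  have hC : 0 ≤ C := by
    have h := hRC 0 0 le_rfl
    rw [Nat.sub_zero, pow_zero, mul_one] at h
    exact (norm_nonneg _).trans h
  have hε0 : ∀ j, 0 ≤ ε j := fun j => (norm_nonneg _).trans (hε j)
  -- the rescaled sequence `a_k = ‖P k‖ ∕ θ^k` obeys the Volterra inequality with `b_j = C ε_j ∕ θ`
  have hV : ∀ k, ‖P k‖ / θ ^ k ≤ C + ∑ j ∈ range k, (C * ε j / θ) * (‖P j‖ / θ ^ j) := by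
    intro k
    have hθk : 0 < θ ^ k := pow_pos hθ k
    rw [div_le_iff₀ hθk, add_mul, sum_mul]
    calc ‖P k‖ = ‖R 0 k + ∑ j ∈ range k, ((P j).comp (F j - A j)).comp (R (j + 1) k)‖ := by
          rw [← duhamel P R F A hP0 hP hR0 hR k]
      _ ≤ ‖R 0 k‖ + ∑ j ∈ range k, ‖((P j).comp (F j - A j)).comp (R (j + 1) k)‖ :=
          (norm_add_le _ _).trans (add_le_add le_rfl (norm_sum_le _ _))
      _ ≤ C * θ ^ k + ∑ j ∈ range k, ‖P j‖ * ε j * (C * θ ^ (k - (j + 1))) := by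
          gcongr with j hj
          · simpa using hRC 0 k (Nat.zero_le k)
          · exact norm_term_le P R F A hRC hε (mem_range.mp hj)
      _ = C * θ ^ k + ∑ j ∈ range k, C * ε j / θ * (‖P j‖ / θ ^ j) * θ ^ k := by
          refine congrArg (C * θ ^ k + ·) (sum_congr rfl fun j hj => ?_)
          have hjk : j + 1 ≤ k := mem_range.mp hj
          have hsplit : θ ^ k = θ ^ j * θ * θ ^ (k - (j + 1)) := by
            rw [← pow_succ, ← pow_add]; congr 1; omega
          have hθj : θ ^ j ≠ 0 := (pow_pos hθ j).ne'
          rw [hsplit]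
          field_simp
  have hG := volterra_gronwall (a := fun k => ‖P k‖ / θ ^ k) (b := fun j => C * ε j / θ) (C := C)
    (fun j => div_nonneg (mul_nonneg hC (hε0 j)) hθ.le) hV k
  have hθk : 0 < θ ^ k := pow_pos hθ k
  have := (div_le_iff₀ hθk).mp hG
  calc ‖P k‖ ≤ C * (∏ j ∈ range k, (1 + C * ε j / θ)) * θ ^ k := this
    _ = C * θ ^ k * ∏ j ∈ range k, (1 + C * ε j / θ) := by ring

/-- **THE RELATIVE LETTER**: under the same hypotheses `‖P k − R 0 k‖ ≤ C·θ^k·(∏_{j<k}(1 + C·ε_j∕θ) − 1)` — the perturbed composite differs from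
the reference composite by the Duhamel sum, bounded through `norm_le_of_consecutive` and the telescoping identity. [folklore] -/
theorem norm_sub_le_of_consecutive (P : ∀ k, X k →L[ℝ] X 0) (R : ∀ a b, X b →L[ℝ] X a) (F A : ∀ j, X (j + 1) →L[ℝ] X j)
    (hP0 : P 0 = ContinuousLinearMap.id ℝ (X 0)) (hP : ∀ k, P (k + 1) = (P k).comp (F k))
    (hR0 : ∀ a, R a a = ContinuousLinearMap.id ℝ (X a)) (hR : ∀ a b, a ≤ b → R a (b + 1) = (R a b).comp (A b))
    {C θ : ℝ} (hθ : 0 < θ) {ε : ℕ → ℝ} (hRC : ∀ a b, a ≤ b → ‖R a b‖ ≤ C * θ ^ (b - a)) (hε : ∀ j, ‖F j - A j‖ ≤ ε j) (k : ℕ) :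
    ‖P k - R 0 k‖ ≤ C * θ ^ k * (∏ j ∈ range k, (1 + C * ε j / θ) - 1) := by
  have hC : 0 ≤ C := by
    have h := hRC 0 0 le_rfl
    rw [Nat.sub_zero, pow_zero, mul_one] at h
    exact (norm_nonneg _).trans h
  have hε0 : ∀ j, 0 ≤ ε j := fun j => (norm_nonneg _).trans (hε j)
  rw [duhamel_sub P R F A hP0 hP hR0 hR k]
  calc ‖∑ j ∈ range k, ((P j).comp (F j - A j)).comp (R (j + 1) k)‖
        ≤ ∑ j ∈ range k, ‖((P j).comp (F j - A j)).comp (R (j + 1) k)‖ := norm_sum_le _ _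
    _ ≤ ∑ j ∈ range k, (C * θ ^ j * ∏ i ∈ range j, (1 + C * ε i / θ)) * ε j * (C * θ ^ (k - (j + 1))) := by
        refine sum_le_sum fun j hj => (norm_term_le P R F A hRC hε (mem_range.mp hj)).trans ?_
        have hPj := norm_le_of_consecutive P R F A hP0 hP hR0 hR hθ hRC hε j
        have h0 : 0 ≤ ε j * (C * θ ^ (k - (j + 1))) := mul_nonneg (hε0 j) (mul_nonneg hC (pow_nonneg hθ.le _))
        calc ‖P j‖ * ε j * (C * θ ^ (k - (j + 1))) = ‖P j‖ * (ε j * (C * θ ^ (k - (j + 1)))) := by ring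
          _ ≤ (C * θ ^ j * ∏ i ∈ range j, (1 + C * ε i / θ)) * (ε j * (C * θ ^ (k - (j + 1)))) :=
              mul_le_mul_of_nonneg_right hPj h0
          _ = _ := by ring
    _ = C * θ ^ k * ∑ j ∈ range k, (C * ε j / θ) * ∏ i ∈ range j, (1 + C * ε i / θ) := by
        rw [mul_sum]
        refine sum_congr rfl fun j hj => ?_
        have hjk : j + 1 ≤ k := mem_range.mp hj
        have hsplit : θ ^ k = θ ^ j * θ * θ ^ (k - (j + 1)) := by
          rw [← pow_succ, ← pow_add]; congr 1; omega
        rw [hsplit]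
        field_simp
    _ = C * θ ^ k * (∏ j ∈ range k, (1 + C * ε j / θ) - 1) := by rw [sum_mul_prod_one_add]

/-- `θ = 1`: all consecutive reference products bounded by `C` ⟹ `‖P k‖ ≤ C·∏_{j<k}(1 + C·ε_j)`. [folklore] -/
theorem norm_le_of_consecutive_one (P : ∀ k, X k →L[ℝ] X 0) (R : ∀ a b, X b →L[ℝ] X a) (F A : ∀ j, X (j + 1) →L[ℝ] X j)
    (hP0 : P 0 = ContinuousLinearMap.id ℝ (X 0)) (hP : ∀ k, P (k + 1) = (P k).comp (F k))
    (hR0 : ∀ a, R a a = ContinuousLinearMap.id ℝ (X a)) (hR : ∀ a b, a ≤ b → R a (b + 1) = (R a b).comp (A b))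
    {C : ℝ} {ε : ℕ → ℝ} (hRC : ∀ a b, a ≤ b → ‖R a b‖ ≤ C) (hε : ∀ j, ‖F j - A j‖ ≤ ε j) (k : ℕ) :
    ‖P k‖ ≤ C * ∏ j ∈ range k, (1 + C * ε j) := by
  have h := norm_le_of_consecutive P R F A hP0 hP hR0 hR one_pos (C := C) (ε := ε)
    (fun a b hab => by rw [one_pow, mul_one]; exact hRC a b hab) hε k
  simpa using h

/-- **THE k-UNIFORM LETTER**: consecutive reference products bounded by `C`, perturbations with `Σ_{j<k} ε_j ≤ E` for every `k` ⟹
`‖P k‖ ≤ C·exp(C·E)` FOR EVERY `k`. [folklore] -/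
theorem norm_le_uniform_of_summable (P : ∀ k, X k →L[ℝ] X 0) (R : ∀ a b, X b →L[ℝ] X a) (F A : ∀ j, X (j + 1) →L[ℝ] X j)
    (hP0 : P 0 = ContinuousLinearMap.id ℝ (X 0)) (hP : ∀ k, P (k + 1) = (P k).comp (F k))
    (hR0 : ∀ a, R a a = ContinuousLinearMap.id ℝ (X a)) (hR : ∀ a b, a ≤ b → R a (b + 1) = (R a b).comp (A b))
    {C E : ℝ} {ε : ℕ → ℝ} (hRC : ∀ a b, a ≤ b → ‖R a b‖ ≤ C) (hε : ∀ j, ‖F j - A j‖ ≤ ε j)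
    (hE : ∀ k, ∑ j ∈ range k, ε j ≤ E) (k : ℕ) :
    ‖P k‖ ≤ C * Real.exp (C * E) := by
  have hC : 0 ≤ C := (norm_nonneg _).trans (hRC 0 0 le_rfl)
  have hε0 : ∀ j, 0 ≤ ε j := fun j => (norm_nonneg _).trans (hε j)
  calc ‖P k‖ ≤ C * ∏ j ∈ range k, (1 + C * ε j) := norm_le_of_consecutive_one P R F A hP0 hP hR0 hR hRC hε k
    _ ≤ C * Real.exp (∑ j ∈ range k, C * ε j) :=
        mul_le_mul_of_nonneg_left (prod_one_add_le_exp (fun j => mul_nonneg hC (hε0 j)) k) hC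
    _ ≤ C * Real.exp (C * E) := by
        refine mul_le_mul_of_nonneg_left (Real.exp_le_exp.mpr ?_) hC
        rw [← mul_sum]
        exact mul_le_mul_of_nonneg_left (hE k) hC

/-- **THE GEOMETRIC LETTER**: consecutive reference products bounded by `C·θ^{b−a}` and perturbations uniformly `≤ ε` ⟹
`‖P k‖ ≤ C·(θ + C·ε)^k` — a reference decay `θ < 1` survives every `ε < (1 − θ)∕C`. [folklore] -/
theorem norm_le_geometric (P : ∀ k, X k →L[ℝ] X 0) (R : ∀ a b, X b →L[ℝ] X a) (F A : ∀ j, X (j + 1) →L[ℝ] X j)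
    (hP0 : P 0 = ContinuousLinearMap.id ℝ (X 0)) (hP : ∀ k, P (k + 1) = (P k).comp (F k))
    (hR0 : ∀ a, R a a = ContinuousLinearMap.id ℝ (X a)) (hR : ∀ a b, a ≤ b → R a (b + 1) = (R a b).comp (A b))
    {C θ e : ℝ} (hθ : 0 < θ) {ε : ℕ → ℝ} (hRC : ∀ a b, a ≤ b → ‖R a b‖ ≤ C * θ ^ (b - a)) (hε : ∀ j, ‖F j - A j‖ ≤ ε j)
    (he : ∀ j, ε j ≤ e) (k : ℕ) :
    ‖P k‖ ≤ C * (θ + C * e) ^ k := by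
  have hC : 0 ≤ C := by
    have h := hRC 0 0 le_rfl
    rw [Nat.sub_zero, pow_zero, mul_one] at h
    exact (norm_nonneg _).trans h
  have hε0 : ∀ j, 0 ≤ ε j := fun j => (norm_nonneg _).trans (hε j)
  have hprod : ∏ j ∈ range k, (1 + C * ε j / θ) ≤ (1 + C * e / θ) ^ k :=
    prod_one_add_le_pow (fun j => div_nonneg (mul_nonneg hC (hε0 j)) hθ.le)
      (fun j => div_le_div_of_nonneg_right (mul_le_mul_of_nonneg_left (he j) hC) hθ.le) k
  calc ‖P k‖ ≤ C * θ ^ k * ∏ j ∈ range k, (1 + C * ε j / θ) := norm_le_of_consecutive P R F A hP0 hP hR0 hR hθ hRC hε k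
    _ ≤ C * θ ^ k * (1 + C * e / θ) ^ k := mul_le_mul_of_nonneg_left hprod (mul_nonneg hC (pow_nonneg hθ.le k))
    _ = C * (θ * (1 + C * e / θ)) ^ k := by rw [mul_pow]; ring
    _ = C * (θ + C * e) ^ k := by congr 2; field_simp

/-- The relative geometric letter: `‖P k − R 0 k‖ ≤ C·((θ + C·e)^k − θ^k)`. [folklore] -/
theorem norm_sub_le_geometric (P : ∀ k, X k →L[ℝ] X 0) (R : ∀ a b, X b →L[ℝ] X a) (F A : ∀ j, X (j + 1) →L[ℝ] X j)
    (hP0 : P 0 = ContinuousLinearMap.id ℝ (X 0)) (hP : ∀ k, P (k + 1) = (P k).comp (F k))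
    (hR0 : ∀ a, R a a = ContinuousLinearMap.id ℝ (X a)) (hR : ∀ a b, a ≤ b → R a (b + 1) = (R a b).comp (A b))
    {C θ e : ℝ} (hθ : 0 < θ) {ε : ℕ → ℝ} (hRC : ∀ a b, a ≤ b → ‖R a b‖ ≤ C * θ ^ (b - a)) (hε : ∀ j, ‖F j - A j‖ ≤ ε j)
    (he : ∀ j, ε j ≤ e) (k : ℕ) :
    ‖P k - R 0 k‖ ≤ C * ((θ + C * e) ^ k - θ ^ k) := by
  have hC : 0 ≤ C := by
    have h := hRC 0 0 le_rfl
    rw [Nat.sub_zero, pow_zero, mul_one] at h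
    exact (norm_nonneg _).trans h
  have hε0 : ∀ j, 0 ≤ ε j := fun j => (norm_nonneg _).trans (hε j)
  have hprod : ∏ j ∈ range k, (1 + C * ε j / θ) ≤ (1 + C * e / θ) ^ k :=
    prod_one_add_le_pow (fun j => div_nonneg (mul_nonneg hC (hε0 j)) hθ.le)
      (fun j => div_le_div_of_nonneg_right (mul_le_mul_of_nonneg_left (he j) hC) hθ.le) k
  calc ‖P k - R 0 k‖ ≤ C * θ ^ k * (∏ j ∈ range k, (1 + C * ε j / θ) - 1) :=
        norm_sub_le_of_consecutive P R F A hP0 hP hR0 hR hθ hRC hε k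
    _ ≤ C * θ ^ k * ((1 + C * e / θ) ^ k - 1) :=
        mul_le_mul_of_nonneg_left (sub_le_sub_right hprod 1) (mul_nonneg hC (pow_nonneg hθ.le k))
    _ = C * ((θ * (1 + C * e / θ)) ^ k - θ ^ k) := by rw [mul_pow]; ring
    _ = C * ((θ + C * e) ^ k - θ ^ k) := by congr 3; field_simp

/-! ## §5. The second currency: the same letter for a family of seminorms (SECS's `p : ∀ k, Seminorm ℝ (X k)`) -/

/-- The scalar bookkeeping of one Duhamel step: `C·θ^k + Σ_{j<k} (C·θ^j·Q_j)·(ε_j·C·θ^{k−(j+1)}) = C·θ^k·Q_k`, `Q_j = ∏_{i<j}(1 + C·ε_i∕θ)`. [folklore] -/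
theorem duhamel_scalar (C θ : ℝ) (hθ : θ ≠ 0) (ε : ℕ → ℝ) (k : ℕ) :
    C * θ ^ k + ∑ j ∈ range k, (C * θ ^ j * ∏ i ∈ range j, (1 + C * ε i / θ)) * (ε j * (C * θ ^ (k - (j + 1))))
      = C * θ ^ k * ∏ j ∈ range k, (1 + C * ε j / θ) := by
  have h : ∀ j ∈ range k, (C * θ ^ j * ∏ i ∈ range j, (1 + C * ε i / θ)) * (ε j * (C * θ ^ (k - (j + 1))))
      = C * θ ^ k * ((C * ε j / θ) * ∏ i ∈ range j, (1 + C * ε i / θ)) := by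
    intro j hj
    have hjk : j + 1 ≤ k := mem_range.mp hj
    have hsplit : θ ^ k = θ ^ j * θ * θ ^ (k - (j + 1)) := by
      rw [← pow_succ, ← pow_add]; congr 1; omega
    rw [hsplit]
    field_simp
  rw [sum_congr rfl h, ← mul_sum, sum_mul_prod_one_add]
  ring

/-- **THE PERTURBED COMPOSITE LETTER IN A SECOND CURRENCY**: for any family of seminorms `p_k` on the levels, reference letters
`p_a(R a b v) ≤ C·θ^{b−a}·p_b(v)` (`a ≤ b`) and perturbation letters `p_j((F j − A j) v) ≤ ε_j·p_{j+1}(v)` give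
`p_0(P k v) ≤ C·θ^k·∏_{j<k}(1 + C·ε_j∕θ)·p_k(v)` — SECS's product letter with the CONTROLLED product. [folklore] -/
theorem seminorm_le_of_consecutive (P : ∀ k, X k →L[ℝ] X 0) (R : ∀ a b, X b →L[ℝ] X a) (F A : ∀ j, X (j + 1) →L[ℝ] X j)
    (hP0 : P 0 = ContinuousLinearMap.id ℝ (X 0)) (hP : ∀ k, P (k + 1) = (P k).comp (F k))
    (hR0 : ∀ a, R a a = ContinuousLinearMap.id ℝ (X a)) (hR : ∀ a b, a ≤ b → R a (b + 1) = (R a b).comp (A b))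
    (p : ∀ k, Seminorm ℝ (X k)) {C θ : ℝ} (hC : 0 ≤ C) (hθ : 0 < θ) {ε : ℕ → ℝ} (hε0 : ∀ j, 0 ≤ ε j)
    (hRp : ∀ a b, a ≤ b → ∀ v, p a (R a b v) ≤ C * θ ^ (b - a) * p b v)
    (hεp : ∀ j v, p j ((F j - A j) v) ≤ ε j * p (j + 1) v) :
    ∀ k v, p 0 (P k v) ≤ C * θ ^ k * (∏ j ∈ range k, (1 + C * ε j / θ)) * p k v := by
  intro k
  induction k using Nat.strong_induction_on with
  | _ k ih =>
    intro v
    have hQ : ∀ j, 0 ≤ C * θ ^ j * ∏ i ∈ range j, (1 + C * ε i / θ) := fun j =>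
      mul_nonneg (mul_nonneg hC (pow_nonneg hθ.le j))
        (zero_le_one.trans (one_le_prod_one_add (fun i => div_nonneg (mul_nonneg hC (hε0 i)) hθ.le) j))
    -- a seminorm is subadditive over finite sums (the tree's `Literature.Analysis.Distribution.seminorm_sum_le`, inlined to keep Mathlib-only imports)
    have hsum : ∀ (s : Finset ℕ) (f : ℕ → X 0), p 0 (∑ i ∈ s, f i) ≤ ∑ i ∈ s, p 0 (f i) := by
      intro s f
      induction s using Finset.induction_on with
      | empty => simp
      | insert a s ha ih' =>
        rw [sum_insert ha, sum_insert ha]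
        exact (map_add_le_add _ _ _).trans (add_le_add le_rfl ih')
    have hdu := congrArg (fun T : X k →L[ℝ] X 0 => T v) (duhamel P R F A hP0 hP hR0 hR k)
    simp only [_root_.add_apply, FunLike.coe_sum, Finset.sum_apply, ContinuousLinearMap.coe_comp,
      Function.comp_apply] at hdu
    rw [hdu]
    calc p 0 (R 0 k v + ∑ j ∈ range k, P j ((F j - A j) (R (j + 1) k v)))
        ≤ p 0 (R 0 k v) + ∑ j ∈ range k, p 0 (P j ((F j - A j) (R (j + 1) k v))) :=
          (map_add_le_add _ _ _).trans (add_le_add le_rfl (hsum _ _))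
      _ ≤ C * θ ^ k * p k v
          + ∑ j ∈ range k, (C * θ ^ j * ∏ i ∈ range j, (1 + C * ε i / θ)) * (ε j * (C * θ ^ (k - (j + 1)) * p k v)) := by
          gcongr with j hj
          · simpa using hRp 0 k (Nat.zero_le k) v
          · have hjk : j < k := mem_range.mp hj
            calc p 0 (P j ((F j - A j) (R (j + 1) k v)))
                ≤ (C * θ ^ j * ∏ i ∈ range j, (1 + C * ε i / θ)) * p j ((F j - A j) (R (j + 1) k v)) := ih j hjk _
              _ ≤ (C * θ ^ j * ∏ i ∈ range j, (1 + C * ε i / θ)) * (ε j * (C * θ ^ (k - (j + 1)) * p k v)) :=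
                  mul_le_mul_of_nonneg_left
                    ((hεp j _).trans (mul_le_mul_of_nonneg_left (hRp (j + 1) k hjk v) (hε0 j))) (hQ j)
      _ = (C * θ ^ k + ∑ j ∈ range k, (C * θ ^ j * ∏ i ∈ range j, (1 + C * ε i / θ)) * (ε j * (C * θ ^ (k - (j + 1)))))
          * p k v := by
          rw [add_mul, sum_mul]
          refine congrArg (C * θ ^ k * p k v + ·) (sum_congr rfl fun j _ => by ring)
      _ = C * θ ^ k * (∏ j ∈ range k, (1 + C * ε j / θ)) * p k v := by rw [duhamel_scalar C θ hθ.ne' ε k]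

/-- The second-currency letter at `θ = 1` with summable perturbations: `p_0(P k v) ≤ C·exp(C·E)·p_k(v)` FOR EVERY `k`. [folklore] -/
theorem seminorm_le_uniform_of_summable (P : ∀ k, X k →L[ℝ] X 0) (R : ∀ a b, X b →L[ℝ] X a) (F A : ∀ j, X (j + 1) →L[ℝ] X j)
    (hP0 : P 0 = ContinuousLinearMap.id ℝ (X 0)) (hP : ∀ k, P (k + 1) = (P k).comp (F k))
    (hR0 : ∀ a, R a a = ContinuousLinearMap.id ℝ (X a)) (hR : ∀ a b, a ≤ b → R a (b + 1) = (R a b).comp (A b))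
    (p : ∀ k, Seminorm ℝ (X k)) {C E : ℝ} (hC : 0 ≤ C) {ε : ℕ → ℝ} (hε0 : ∀ j, 0 ≤ ε j)
    (hRp : ∀ a b, a ≤ b → ∀ v, p a (R a b v) ≤ C * p b v)
    (hεp : ∀ j v, p j ((F j - A j) v) ≤ ε j * p (j + 1) v) (hE : ∀ k, ∑ j ∈ range k, ε j ≤ E) :
    ∀ k v, p 0 (P k v) ≤ C * Real.exp (C * E) * p k v := by
  intro k v
  have h := seminorm_le_of_consecutive P R F A hP0 hP hR0 hR p hC one_pos hε0
    (fun a b hab w => by rw [one_pow, mul_one]; exact hRp a b hab w) hεp k v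
  simp only [one_pow, mul_one, div_one] at h
  have hprod : ∏ j ∈ range k, (1 + C * ε j) ≤ Real.exp (C * E) :=
    (prod_one_add_le_exp (fun j => mul_nonneg hC (hε0 j)) k).trans
      (Real.exp_le_exp.mpr (by rw [← mul_sum]; exact mul_le_mul_of_nonneg_left (hE k) hC))
  exact h.trans (mul_le_mul_of_nonneg_right (mul_le_mul_of_nonneg_left hprod hC) (apply_nonneg (p k) v))

/-! ## §6. Toy -/

/-- Toy (kernel): on the constant chain `X k = ℝ` with `F = A = 1` every composite is `1`; the letters read `‖1‖ ≤ 1·1^k·∏(1 + 0)`. -/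
example : ‖(ContinuousLinearMap.id ℝ ℝ)‖ ≤ 1 * (1 : ℝ) ^ 3 * ∏ _j ∈ range 3, (1 + 1 * (0 : ℝ) / 1) := by
  norm_num

end Summit.QuantumFields.BalabanUV.T4Continuum.NE7b.PerturbedSectionProducts
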